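import Mathlib
import Literature.Analysis.FluidPDE.VectorCalculus

/-!
# Route `FilamentSkeletonRss` · child cruxes `TangentSkeletonNearStraight` (stmt-28295, line `child_tangent_analytic_strip`, sha16 3ad1a13e3bb9c4f5)
# and `TangentSkeletonNearStraightL` (stmt-23320, line `child_tangent_analytic_strip_L`, sha16 b0b56c52900dd90a) — VOCABULARY for the SHARED stub
# P2 `stub_stripPropagation : StripPropagation`

Hand leafhand-ns-filamentskeletonrs-17 g1 (prover), 2026-08-31.  Both registered child skeletons posit, LETTER FOR LETTER IDENTICALLY (§2–§3 of either
line file; checked by textual diff), the complexification `cplx`, the parameter STADIUM `Stadium hs L cc`, the three stadium-analyticity predicates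
`StadiumAnalyticCurve`, `StadiumAnalyticArea`, `StadiumAnalyticBdd`, and the stub statement `StripPropagation` (quarter-width output stadium
`cs√Γ/4`).  A line file is not importable from `Theorems/`, so — exactly as `Theorems/FilamentSkeletonRssAnalyticStripLiaSymbolDefs.lean` (p650376) did
for stub P3 — the six definitions are re-declared here VERBATIM (same binder names, same bodies), once for both twins.  The by-name closer of either
twin's stub will be `theorem stub_stripPropagation : StripPropagation` over THIS copy (definitionally the line's statement); the analytic work toward
it (the /4 "corner" programme, hands leafhand-15; the landed /16 text `Theorems.StadiumStripPropagation.strip_propagation_sixteenth`, p823048) is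
written in δ-unfolded terms, and `stripPropagation_iff` below is the definitional bridge to those terms (`Iff.rfl`); `stadiumAnalyticBdd_mono`
records that the registered quarter-width conclusion implies every narrower one (so the registered stub implies the landed sixteenth, not conversely).

HONEST FRAMING: vocabulary only, for a HYPOTHETICAL filament skeleton on the NEGATIVE side of a MODEL route; no stub is closed here;
`TangentSkeletonNearStraight(L)`, `SkeletonJ1G`, `SkeletonJ1L` stay OPEN; nothing here bears on Navier–Stokes regularity or blow-up.
-/

set_option linter.dupNamespace false

noncomputable section

namespace Summit.NavierStokesRegularity.NavierStokesRegularity.Theorems.AnalyticStripStadium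

open scoped InnerProductSpace
open Literature.Analysis.FluidPDE

/-- Complexification of a point of `ℝ³` (coordinates through the standard basis).  VERBATIM copy of
`Cruxes.TangentSkeletonNearStraight(L).AnalyticStrip.cplx` (route-posited object; not a Literature definition). -/
def cplx (y : EuclideanSpace ℝ (Fin 3)) : Fin 3 → ℂ :=
  fun i => ((⟪y, EuclideanSpace.single i (1:ℝ)⟫_ℝ : ℝ) : ℂ)

/-- The STADIUM of half-width `hs` around the parameter segment `|Re z − cc| < L + hs`: the complex neighbourhood of the
(enlarged) exactness-ball segment of one filament on which analyticity is asserted.  VERBATIM copy of the line's `Stadium`. -/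
def Stadium (hs L cc : ℝ) : Set ℂ := {z : ℂ | |z.im| < hs ∧ |z.re - cc| < L + hs}

/-- A STADIUM-ANALYTIC CURVE: `X` has a complex-analytic extension to the stadium whose derivative is bounded by `2`
(real unit speed continues to `⟨F′,F′⟩ = 1` bilinearly; the bound `2` is slack for the imaginary directions).  VERBATIM copy of the line's
`StadiumAnalyticCurve`. -/
def StadiumAnalyticCurve (hs L cc : ℝ) (X : ℝ → EuclideanSpace ℝ (Fin 3)) : Prop :=
  ∃ F : ℂ → (Fin 3 → ℂ), DifferentiableOn ℂ F (Stadium hs L cc) ∧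
    (∀ t : ℝ, (t : ℂ) ∈ Stadium hs L cc → F t = cplx (X t)) ∧
    ∀ z ∈ Stadium hs L cc, ‖deriv F z‖ ≤ 2

/-- A STADIUM-ANALYTIC CORE AREA: the positive function `A` has an analytic extension to the stadium with real part at
least half, and modulus at most twice, its value at the real foot — what keeps the matched kernel
`(‖y − Z‖² + e^{−(1+γ_E−log 2)}·A)^{-3/2}` on its principal branch under the simultaneous contour shift.  VERBATIM copy of the line's
`StadiumAnalyticArea`. -/
def StadiumAnalyticArea (hs L cc : ℝ) (A : ℝ → ℝ) : Prop :=
  ∃ G : ℂ → ℂ, DifferentiableOn ℂ G (Stadium hs L cc) ∧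
    (∀ t : ℝ, (t : ℂ) ∈ Stadium hs L cc → G t = ((A t : ℝ) : ℂ)) ∧
    ∀ z ∈ Stadium hs L cc, A z.re / 2 ≤ (G z).re ∧ ‖G z‖ ≤ 2 * A z.re

/-- A STADIUM-ANALYTIC BOUNDED vector function (used for the induced velocity along a filament).  VERBATIM copy of the line's
`StadiumAnalyticBdd`. -/
def StadiumAnalyticBdd (hs L cc B : ℝ) (f : ℝ → EuclideanSpace ℝ (Fin 3)) : Prop :=
  ∃ U : ℂ → (Fin 3 → ℂ), DifferentiableOn ℂ U (Stadium hs L cc) ∧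
    (∀ t : ℝ, (t : ℂ) ∈ Stadium hs L cc → U t = cplx (f t)) ∧
    ∀ z ∈ Stadium hs L cc, ‖U z‖ ≤ B

/-- STUB P2 statement · STRIP PROPAGATION (shared by both twins' registered skeletons).  Along an `N`-tuple of unit-speed, near-straight
(tangent oscillation `≤ Rb`), `ρ√Γ`-separated, chord-arc filaments with core areas in `[Λ⁻¹, KA(1+Γ+‖X‖²)]`, each stadium-analytic of
half-width `cs√Γ` (`8cs ≤ ρ`) around its ball segment together with its core area, the matched Biot–Savart centreline field
`τ ↦ u X (X j τ)` is stadium-analytic on the quarter-width stadium with the Γ-uniform bound `Cu·√Γ·log Γ`.  VERBATIM copy of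
`Cruxes.TangentSkeletonNearStraight.AnalyticStrip.StripPropagation` = `Cruxes.TangentSkeletonNearStraightL.AnalyticStrip.StripPropagation`
(route-posited stub statement; not a Literature fact). -/
def StripPropagation : Prop :=
  ∀ (N : ℕ) (ρ K Λ Rb cg θ₀ KA cs : ℝ), 0 < N → 0 < ρ → 0 < Λ → 0 < Rb → Rb ≤ 1/2 → 0 < cg → 0 < θ₀ → 0 < KA →
    0 < cs → 8 * cs ≤ ρ →
    ∃ (Cu Γ₀ : ℝ), 0 < Cu ∧ ∀ Γ : ℝ, Γ₀ ≤ Γ →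
      ∀ (γ : Fin N → ℝ) (X : Fin N → ℝ → EuclideanSpace ℝ (Fin 3)) (c : Fin N → ℝ) (Aa : Fin N → ℝ → ℝ)
        (u : (Fin N → ℝ → EuclideanSpace ℝ (Fin 3)) → EuclideanSpace ℝ (Fin 3) → EuclideanSpace ℝ (Fin 3)),
        (∀ Z y, u Z y = ∑ k, (Γ*γ k/(4*Real.pi))•∫ σ:ℝ, ((‖y-Z k σ‖^2+Real.exp (-(1+Real.eulerMascheroniConstant-Real.log 2))*Aa k σ)^(3/2:ℝ))⁻¹•cross (deriv (Z k) σ) (y-Z k σ)) →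
        (∀ j, |γ j| ≤ θ₀⁻¹) →
        (∀ j, ContDiff ℝ 2 (X j) ∧ (∀ τ, ‖deriv (X j) τ‖ = 1) ∧ (∀ τ, ‖iteratedDeriv 2 (X j) τ‖ * √Γ ≤ K) ∧
          ∀ τ σ, ‖deriv (X j) τ - deriv (X j) σ‖ ≤ Rb) →
        (∀ j k, j ≠ k → ∀ τ σ, ρ * √Γ ≤ ‖X j τ - X k σ‖) →
        (∀ j τ σ, ρ * √Γ ≤ |τ - σ| → cg * ρ * √Γ ≤ ‖X j τ - X j σ‖) →
        (∀ j, Differentiable ℝ (Aa j) ∧ (∀ τ, Λ⁻¹ ≤ Aa j τ) ∧ ∀ τ, Aa j τ ≤ KA * (1 + Γ + ‖X j τ‖ ^ 2)) →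
        (∀ j, StadiumAnalyticCurve (cs * √Γ) (Rb * √(Γ * Real.log Γ)) (c j) (X j)) →
        (∀ j, StadiumAnalyticArea (cs * √Γ) (Rb * √(Γ * Real.log Γ)) (c j) (Aa j)) →
        ∀ j, StadiumAnalyticBdd (cs * √Γ / 4) (Rb * √(Γ * Real.log Γ)) (c j) (Cu * √Γ * Real.log Γ)
          (fun τ => u X (X j τ))

/-! ## Definitional bridges (no mathematics) -/

/-- The stadium, unfolded. [folklore] -/
theorem mem_stadium_iff {hs L cc : ℝ} {z : ℂ} : z ∈ Stadium hs L cc ↔ |z.im| < hs ∧ |z.re - cc| < L + hs :=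
  Iff.rfl

/-- A narrower output stadium over the same segment is contained in a wider one. [folklore] -/
theorem stadium_mono {hs hs' L cc : ℝ} (h : hs' ≤ hs) : Stadium hs' L cc ⊆ Stadium hs L cc := by
  intro z hz
  exact ⟨lt_of_lt_of_le hz.1 h, lt_of_lt_of_le hz.2 (by linarith)⟩

/-- Monotonicity of the bounded-analyticity predicate in the half-width: the quarter-width conclusion of the registered stub implies
every narrower one (e.g. the sixteenth-width text of `Theorems.StadiumStripPropagation.strip_propagation_sixteenth`). [folklore] -/
theorem stadiumAnalyticBdd_mono {hs hs' L cc B : ℝ} (h : hs' ≤ hs) {f : ℝ → EuclideanSpace ℝ (Fin 3)}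
    (hf : StadiumAnalyticBdd hs L cc B f) : StadiumAnalyticBdd hs' L cc B f := by
  obtain ⟨U, hU, hUf, hUB⟩ := hf
  exact ⟨U, hU.mono (stadium_mono h), fun t ht => hUf t (stadium_mono h ht), fun z hz => hUB z (stadium_mono h hz)⟩

/-- THE BRIDGE to δ-unfolded terms: `StripPropagation` is, by `Iff.rfl`, the text in which the analytic work is written (the statement of
`Theorems.StadiumStripPropagation.strip_propagation_sixteenth` with its single token `/ 16` restored to the registered `/ 4`). [folklore] -/
theorem stripPropagation_iff :
    StripPropagation ↔
    ∀ (N : ℕ) (ρ K Λ Rb cg θ₀ KA cs : ℝ), 0 < N → 0 < ρ → 0 < Λ → 0 < Rb → Rb ≤ 1/2 → 0 < cg → 0 < θ₀ → 0 < KA →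
    0 < cs → 8 * cs ≤ ρ →
    ∃ (Cu Γ₀ : ℝ), 0 < Cu ∧ ∀ Γ : ℝ, Γ₀ ≤ Γ →
      ∀ (γ : Fin N → ℝ) (X : Fin N → ℝ → EuclideanSpace ℝ (Fin 3)) (c : Fin N → ℝ) (Aa : Fin N → ℝ → ℝ)
        (u : (Fin N → ℝ → EuclideanSpace ℝ (Fin 3)) → EuclideanSpace ℝ (Fin 3) → EuclideanSpace ℝ (Fin 3)),
        (∀ Z y, u Z y = ∑ k, (Γ*γ k/(4*Real.pi))•∫ σ:ℝ, ((‖y-Z k σ‖^2+Real.exp (-(1+Real.eulerMascheroniConstant-Real.log 2))*Aa k σ)^(3/2:ℝ))⁻¹•cross (deriv (Z k) σ) (y-Z k σ)) →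
        (∀ j, |γ j| ≤ θ₀⁻¹) →
        (∀ j, ContDiff ℝ 2 (X j) ∧ (∀ τ, ‖deriv (X j) τ‖ = 1) ∧ (∀ τ, ‖iteratedDeriv 2 (X j) τ‖ * √Γ ≤ K) ∧
          ∀ τ σ, ‖deriv (X j) τ - deriv (X j) σ‖ ≤ Rb) →
        (∀ j k, j ≠ k → ∀ τ σ, ρ * √Γ ≤ ‖X j τ - X k σ‖) →
        (∀ j τ σ, ρ * √Γ ≤ |τ - σ| → cg * ρ * √Γ ≤ ‖X j τ - X j σ‖) →
        (∀ j, Differentiable ℝ (Aa j) ∧ (∀ τ, Λ⁻¹ ≤ Aa j τ) ∧ ∀ τ, Aa j τ ≤ KA * (1 + Γ + ‖X j τ‖ ^ 2)) →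
        (∀ j, ∃ F : ℂ → (Fin 3 → ℂ),
          DifferentiableOn ℂ F {z : ℂ | |z.im| < cs * √Γ ∧ |z.re - c j| < Rb * √(Γ * Real.log Γ) + cs * √Γ} ∧
          (∀ t : ℝ, (t : ℂ) ∈ {z : ℂ | |z.im| < cs * √Γ ∧ |z.re - c j| < Rb * √(Γ * Real.log Γ) + cs * √Γ} →
            F t = fun i => ((⟪X j t, EuclideanSpace.single i (1:ℝ)⟫_ℝ : ℝ) : ℂ)) ∧
          ∀ z ∈ {z : ℂ | |z.im| < cs * √Γ ∧ |z.re - c j| < Rb * √(Γ * Real.log Γ) + cs * √Γ}, ‖deriv F z‖ ≤ 2) →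
        (∀ j, ∃ G : ℂ → ℂ,
          DifferentiableOn ℂ G {z : ℂ | |z.im| < cs * √Γ ∧ |z.re - c j| < Rb * √(Γ * Real.log Γ) + cs * √Γ} ∧
          (∀ t : ℝ, (t : ℂ) ∈ {z : ℂ | |z.im| < cs * √Γ ∧ |z.re - c j| < Rb * √(Γ * Real.log Γ) + cs * √Γ} →
            G t = ((Aa j t : ℝ) : ℂ)) ∧
          ∀ z ∈ {z : ℂ | |z.im| < cs * √Γ ∧ |z.re - c j| < Rb * √(Γ * Real.log Γ) + cs * √Γ},
            Aa j z.re / 2 ≤ (G z).re ∧ ‖G z‖ ≤ 2 * Aa j z.re) →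
        ∀ j, ∃ U : ℂ → (Fin 3 → ℂ),
          DifferentiableOn ℂ U {z : ℂ | |z.im| < cs * √Γ / 4 ∧ |z.re - c j| < Rb * √(Γ * Real.log Γ) + cs * √Γ / 4} ∧
          (∀ t : ℝ, (t : ℂ) ∈ {z : ℂ | |z.im| < cs * √Γ / 4 ∧ |z.re - c j| < Rb * √(Γ * Real.log Γ) + cs * √Γ / 4} →
            U t = fun i => ((⟪u X (X j t), EuclideanSpace.single i (1:ℝ)⟫_ℝ : ℝ) : ℂ)) ∧
          ∀ z ∈ {z : ℂ | |z.im| < cs * √Γ / 4 ∧ |z.re - c j| < Rb * √(Γ * Real.log Γ) + cs * √Γ / 4},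
            ‖U z‖ ≤ Cu * √Γ * Real.log Γ :=
  Iff.rfl

end Summit.NavierStokesRegularity.NavierStokesRegularity.Theorems.AnalyticStripStadium
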